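import Summits.NavierStokesRegularity.NavierStokesRegularity.Theorems.StrainDoorsTypeITangentField
import Literature.Analysis.FluidPDE.KNSSThm52Integrand
import HarnessLib

/-!
# Strain doors, PART I — the vorticity record law on the tangent field (ROUND 58 of the ns-regularity-ideate cell, second half)

(Tree file 1 of 2 of PART I — §I1 toolkit and §I2 `tangent_vorticity_eq`; §I3 (the record law) is in
`StrainDoorsTypeITangentLaw`, which imports this file.  Text of nsreg-p1 g35 r58/StrainDoorsTypeITangentLaw.lean
sha256 c4a91e49e5e56002, split at the 400-line cap, bodies verbatim; the local copies `continuousOn_of_norm_sub_le` /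
`norm_laplacian_le_three` are dropped in favour of the tree's `continuousOn_of_norm_sub_le_mul`
(`KNSSRegularityGluing`) / `norm_laplacian_le_three_mul` (`KNSSThm52Integrand`, one extra import), per the gate's dedup rule.)

For every classical Type-I solution `(u,p)` of Navier–Stokes on `(−∞,0) × ℝ³` with `ω ≢ 0`, the tangent field `v`
of PART H (`typeI_tangent_vorticity_attains`) — continuous, Type-I, bounded-weak ancient, with the vorticity number
`W* = sup (0−s)|ω|` of `u` ATTAINED at `(−1, z̄)` — has `C^∞` slices and satisfies the vorticity equation
POINTWISE with a classical time derivative on `s ≤ −1/2` (`tangent_vorticity_eq`: KNSS's window representative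
`v = U + b(t)` has a drift with the CONTINUOUS representative `b̃ = v(·,0) − U(·,0)`, `v = U + b̃` at every time,
the integrated vorticity identity of `KNSS2009_regularity_boundedWeak_window_holds` has a continuous integrand, FTC),
and therefore the VORTICITY RECORD LAW WITH LAPLACIAN CREDIT holds at `(−1, z̄)`
(`typeI_tangent_vorticity_record_law`): `1 ≤ (0 − (−1))(⟪ξ̄, ∇v ξ̄⟫ − |∇ξ̄|²_F)` — the conclusion of door D14's
consumer `typeI_vorticity_law_on_tangent_flow` (PART F), now UNCONDITIONAL (with the honest regularity of the
tangent field in place of "classical").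

References: Koch–Nadirashvili–Seregin–Šverák, Acta Math. 203 (2009), §4 (4.11), Lemma 3.1, §6 [KNSS2009];
Giga–Gu–Hsu, Nonlinear Anal. 189 (2019) 111579, §2 (blow-up limits normalised by velocity).
-/

noncomputable section

open MeasureTheory Set Function Filter Metric Real InnerProductSpace
open _root_.Topology
open scoped ENNReal NNReal RealInnerProductSpace ContDiff Laplacian
open Literature.Analysis Literature.Analysis.FluidPDE
open Literature.Analysis.FluidPDE.VorticityDirectionDynamics

set_option linter.unusedVariables false
set_option linter.unusedSectionVars false

namespace Summit.NavierStokesRegularity.NavierStokesRegularity.Theorems.StrainDoors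

open Summit.NavierStokesRegularity.NavierStokesRegularity.Theorems.ArgmaxDoors

/-! # PART I — THE VORTICITY RECORD LAW ON THE TANGENT FIELD (ROUND 58, second half)

The tangent field `v` of PART H is a bounded weak ancient solution with differentiable slices and a jointly
Lipschitz gradient.  KNSS's window representative `v = U + b(t)` (`KNSS2009_regularity_boundedWeak_window_holds`)
has a drift `b` that is only measurable — but `v` and `U` are continuous in time, so the drift has a CONTINUOUS
representative `b̃(t) = v(t,0) − U(t,0)` with `v = U + b̃` at EVERY time; the integrated vorticity identity of the
window fact then holds with `b̃`, its integrand is continuous in time (all spatial derivatives of `U` are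
Lipschitz in time), and the fundamental theorem of calculus gives the POINTWISE vorticity equation for `v` with a
classical time derivative (§I2).  At the attained record `(−1, z̄)` of PART H the left Fermat inequality and the
argmax inequality of `ArgmaxDoorsGrowth` give the vorticity record law with Laplacian credit (§I3): door D14's
consumer, unconditionally. -/

/-! ## §I1 Time-continuity toolkit for KNSS representatives -/

/-- `curl (f − g) = curl f − curl g` for differentiable fields. [folklore] -/
theorem curl_sub' {f g : (EuclideanSpace ℝ (Fin 3)) → (EuclideanSpace ℝ (Fin 3))}
    (hf : Differentiable ℝ f) (hg : Differentiable ℝ g) : curl (f - g) = curl f - curl g := by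
  funext x
  simp only [Pi.sub_apply, curl_eq_curlCLM]
  rw [fderiv_sub (hf x) (hg x), map_sub]

/-- **Time continuity of a KNSS representative and its derivatives.**  If the slices `U(τ,·)`, `τ ∈ (0,T)`, are
smooth and `‖DᵏU(τ,x) − DᵏU(σ,x)‖ ≤ L_k|τ − σ|` on `(δ,T)` for all `k` (the conclusion (4.11) of
`KNSS2009_regularity_boundedWeak_window_holds`), then at each fixed `x` the maps `τ ↦ U(τ,x)`, `∇U(τ,x)`,
`ω_U(τ,x)`, `∇ω_U(τ,x)`, `Δω_U(τ,x)` are continuous on `(δ,T)`. [folklore] -/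
theorem knss_rep_continuousOn {T δ : ℝ} (hδ : 0 ≤ δ)
    {U : ℝ → (EuclideanSpace ℝ (Fin 3)) → (EuclideanSpace ℝ (Fin 3))} {L : ℕ → ℝ}
    (hUs : ∀ τ ∈ Ioo 0 T, ContDiff ℝ ∞ (U τ))
    (hUL : ∀ k, ∀ σ ∈ Ioo δ T, ∀ τ ∈ Ioo δ T, ∀ x,
      ‖iteratedFDeriv ℝ k (U τ) x - iteratedFDeriv ℝ k (U σ) x‖ ≤ L k * |τ - σ|)
    (x : EuclideanSpace ℝ (Fin 3)) :
    ContinuousOn (fun τ => U τ x) (Ioo δ T) ∧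
    ContinuousOn (fun τ => fderiv ℝ (U τ) x) (Ioo δ T) ∧
    ContinuousOn (fun τ => curl (U τ) x) (Ioo δ T) ∧
    ContinuousOn (fun τ => fderiv ℝ (curl (U τ)) x) (Ioo δ T) ∧
    ContinuousOn (fun τ => (Δ (curl (U τ))) x) (Ioo δ T) := by
  have hsub : Ioo δ T ⊆ Ioo 0 T := Ioo_subset_Ioo_left hδ
  have hs : ∀ τ ∈ Ioo δ T, ContDiff ℝ ∞ (U τ) := fun τ hτ => hUs τ (hsub hτ)
  have hd : ∀ τ ∈ Ioo δ T, Differentiable ℝ (U τ) := fun τ hτ =>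
    (hs τ hτ).differentiable (by norm_cast)
  have hcs : ∀ τ ∈ Ioo δ T, ContDiff ℝ ∞ (curl (U τ)) := fun τ hτ =>
    contDiff_curl (n := ⊤) ((hs τ hτ).of_le (by exact_mod_cast (le_top : (⊤ + 1 : ℕ∞) ≤ ⊤)))
  have ha : ContinuousOn (fun τ => U τ x) (Ioo δ T) :=
    continuousOn_of_norm_sub_le_mul fun σ hσ τ hτ => by
      rw [norm_sub_eq_norm_iteratedFDeriv_zero_sub]; exact hUL 0 σ hσ τ hτ x
  have hb : ContinuousOn (fun τ => fderiv ℝ (U τ) x) (Ioo δ T) :=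
    continuousOn_of_norm_sub_le_mul fun σ hσ τ hτ => by
      rw [norm_fderiv_sub_eq_norm_iteratedFDeriv_one_sub]; exact hUL 1 σ hσ τ hτ x
  have hc : ContinuousOn (fun τ => curl (U τ) x) (Ioo δ T) := by
    have e : (fun τ => curl (U τ) x) = fun τ => curlCLM (fderiv ℝ (U τ) x) := by
      funext τ; exact curl_eq_curlCLM _ _
    rw [e]; exact curlCLM.continuous.comp_continuousOn hb
  have hcsub : ∀ σ ∈ Ioo δ T, ∀ τ ∈ Ioo δ T, curl (U τ) - curl (U σ) = curl (U τ - U σ) :=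
    fun σ hσ τ hτ => (curl_sub' (hd τ hτ) (hd σ hσ)).symm
  have hd' : ContinuousOn (fun τ => fderiv ℝ (curl (U τ)) x) (Ioo δ T) :=
    continuousOn_of_norm_sub_le_mul (L := 4 * L 2) fun σ hσ τ hτ => by
      have h1 : ContDiff ℝ ∞ (U τ - U σ) := (hs τ hτ).sub (hs σ hσ)
      rw [norm_fderiv_sub_eq_norm_iteratedFDeriv_one_sub,
        ← iteratedFDeriv_sub_apply ((hcs τ hτ).of_le (by norm_cast)).contDiffAt
          ((hcs σ hσ).of_le (by norm_cast)).contDiffAt, hcsub σ hσ τ hτ]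
      calc ‖iteratedFDeriv ℝ 1 (curl (U τ - U σ)) x‖
          ≤ 4 * ‖iteratedFDeriv ℝ 2 (U τ - U σ) x‖ := norm_iteratedFDeriv_curl_le_four_mul h1 1 x
        _ = 4 * ‖iteratedFDeriv ℝ 2 (U τ) x - iteratedFDeriv ℝ 2 (U σ) x‖ := by
            rw [iteratedFDeriv_sub_apply ((hs τ hτ).of_le (by norm_cast)).contDiffAt
                ((hs σ hσ).of_le (by norm_cast)).contDiffAt]
        _ ≤ 4 * (L 2 * |τ - σ|) := by gcongr; exact hUL 2 σ hσ τ hτ x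
        _ = 4 * L 2 * |τ - σ| := by ring
  have he : ContinuousOn (fun τ => (Δ (curl (U τ))) x) (Ioo δ T) :=
    continuousOn_of_norm_sub_le_mul (L := 12 * L 3) fun σ hσ τ hτ => by
      have h1 : ContDiff ℝ ∞ (U τ - U σ) := (hs τ hτ).sub (hs σ hσ)
      rw [← ContDiffAt.laplacian_sub ((hcs τ hτ).of_le (by norm_cast)).contDiffAt
          ((hcs σ hσ).of_le (by norm_cast)).contDiffAt, hcsub σ hσ τ hτ]
      calc ‖(Δ (curl (U τ - U σ))) x‖
          ≤ 3 * ‖iteratedFDeriv ℝ 2 (curl (U τ - U σ)) x‖ := norm_laplacian_le_three_mul _ _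
        _ ≤ 3 * (4 * ‖iteratedFDeriv ℝ 3 (U τ - U σ) x‖) := by
            gcongr; exact norm_iteratedFDeriv_curl_le_four_mul h1 2 x
        _ = 12 * ‖iteratedFDeriv ℝ 3 (U τ) x - iteratedFDeriv ℝ 3 (U σ) x‖ := by
            rw [iteratedFDeriv_sub_apply ((hs τ hτ).of_le (by norm_cast)).contDiffAt
                ((hs σ hσ).of_le (by norm_cast)).contDiffAt]
            ring
        _ ≤ 12 * (L 3 * |τ - σ|) := by gcongr; exact hUL 3 σ hσ τ hτ x
        _ = 12 * L 3 * |τ - σ| := by ring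
  exact ⟨ha, hb, hc, hd', he⟩

/-! ## §I2 The tangent field solves the vorticity equation pointwise -/

/-- ★★ **The tangent field is a pointwise vorticity solution with smooth slices.**  Let `v` be continuous on
`ℝ × ℝ³`, Type-I (`|v(t,x)| ≤ C₀/(|x| + √(−t))`) on `t ≤ −1/4`, with `t ↦ v(t − 1/4)` a bounded weak ancient
solution (the output of `typeI_tangent_field`).  Then for every `t₁ ≤ −1/2` the slice `v(t₁,·)` is `C^∞` and
`s ↦ ω_v(s,x)` has at `t₁` the classical time derivative `Δω_v − (v·∇)ω_v + (ω_v·∇)v` evaluated at `(t₁,x)`: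
the vorticity equation holds POINTWISE on `(−∞, −1/2] × ℝ³`.  (KNSS §4 on a window: `v = U + b(t)`; the drift has
the continuous representative `b̃ = v(·,0) − U(·,0)`, `v = U + b̃` everywhere by continuity in time; the integrated
vorticity identity with the continuous integrand + FTC.) [new-combination] -/
theorem tangent_vorticity_eq {C₀ : ℝ}
    {v : ℝ → (EuclideanSpace ℝ (Fin 3)) → (EuclideanSpace ℝ (Fin 3))} (hvc : Continuous (uncurry v))
    (hTypeI : ∀ t ≤ -(1/4 : ℝ), ∀ x, ‖v t x‖ ≤ C₀ / (‖x‖ + √(-t)))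
    (hweak : IsBoundedWeakNSSolutionOn (Iio 0) isOpen_Iio 1 (fun t => v (t - 1/4)))
    {t₁ : ℝ} (ht₁ : t₁ ≤ -(1/2 : ℝ)) (x : EuclideanSpace ℝ (Fin 3)) :
    ContDiff ℝ ∞ (v t₁) ∧
    HasDerivAt (fun t => curl (v t) x)
      ((Δ (curl (v t₁))) x - fderiv ℝ (curl (v t₁)) x (v t₁ x) + fderiv ℝ (v t₁) x (curl (v t₁) x)) t₁ := by
  have hC₀ : 0 ≤ C₀ := by
    have h := (norm_nonneg _).trans (hTypeI (-1) (by norm_num) 0)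
    simpa using h
  -- the window solution `w τ = v (τ + t₁ − 2)` on `(0, 17/8)`
  obtain ⟨T, hT⟩ : ∃ T : ℝ, T = 17/8 := ⟨_, rfl⟩
  have hT0 : (0:ℝ) < T := by rw [hT]; norm_num
  obtain ⟨w, hw⟩ : ∃ w : ℝ → (EuclideanSpace ℝ (Fin 3)) → (EuclideanSpace ℝ (Fin 3)),
      w = fun τ => v (τ + t₁ - 2) := ⟨_, rfl⟩
  have hJ : ∀ t, t ∈ Iio (7/4 - t₁) ↔ t + (t₁ - 7/4) ∈ Iio (0:ℝ) := fun t => by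
    simp only [mem_Iio]; constructor <;> intro h <;> linarith
  have hweakJ := hweak.comp_add_right (t₁ - 7/4) isOpen_Iio hJ
  have hfun : (fun t => (fun t => v (t - 1/4)) (t + (t₁ - 7/4))) = w := by
    funext t; rw [hw]; dsimp only; congr 1; ring
  rw [hfun] at hweakJ
  have hsubJ : Ioo 0 T ⊆ Iio (7/4 - t₁) := fun t ht => by
    simp only [mem_Iio, mem_Ioo, hT] at ht ⊢; linarith
  have hweakW : IsBoundedWeakNSSolutionOn (Ioo 0 T) isOpen_Ioo 1 w := hweakJ.mono isOpen_Ioo hsubJ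
  -- `|w| ≤ 2C₀` on the window
  have htime : ∀ τ ∈ Ioo 0 T, τ + t₁ - 2 ≤ -(1/4 : ℝ) := fun τ hτ => by
    simp only [mem_Ioo, hT] at hτ; linarith
  have hbd : ∀ τ ∈ Ioo 0 T, ∀ y, ‖w τ y‖ ≤ 2 * C₀ := fun τ hτ y => by
    have h1 := hTypeI (τ + t₁ - 2) (htime τ hτ) y
    have hsq : (1/2 : ℝ) ≤ √(-(τ + t₁ - 2)) := by
      have e : (1/2 : ℝ) = √(1/4) := by
        rw [show (1/4 : ℝ) = (1/2) ^ 2 by norm_num, Real.sqrt_sq (by norm_num)]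
      rw [e]; exact Real.sqrt_le_sqrt (by linarith [htime τ hτ])
    have hden : (1/2 : ℝ) ≤ ‖y‖ + √(-(τ + t₁ - 2)) := by linarith [norm_nonneg y]
    calc ‖w τ y‖ = ‖v (τ + t₁ - 2) y‖ := by rw [hw]
      _ ≤ C₀ / (‖y‖ + √(-(τ + t₁ - 2))) := h1
      _ ≤ C₀ / (1/2) := div_le_div_of_nonneg_left hC₀ (by norm_num) hden
      _ = 2 * C₀ := by ring
  -- the KNSS representative on the window
  obtain ⟨Cw, Lw, N, hwin⟩ := KNSS2009_regularity_boundedWeak_window_holds (2 * C₀) T hT0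
  obtain ⟨U, b, -, -, -, hae, hUs, -, -, hUL, hident⟩ := hwin hweakW hbd
  have hSsub : Ioo (1/2 : ℝ) T ⊆ Ioo 0 T := Ioo_subset_Ioo_left (by norm_num)
  -- continuity in time
  have hwcont : ∀ y, Continuous fun τ => w τ y := fun y => by
    rw [hw]
    exact hvc.comp (((continuous_id.add continuous_const).sub continuous_const).prodMk continuous_const)
  have hwcontx : ∀ τ, Continuous (w τ) := fun τ => by
    rw [hw]; exact hvc.comp (continuous_const.prodMk continuous_id)
  have hUline := fun y => knss_rep_continuousOn (T := T) (δ := 1/2) (by norm_num) hUs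
    (fun k σ hσ τ hτ z => hUL (1/2) (by norm_num) k σ hσ τ hτ z) y
  -- the continuous drift `bt = w(·,0) − U(·,0)` and `w = U + bt` at EVERY time of `(1/2, T)`
  obtain ⟨bt, hbt⟩ : ∃ bt : ℝ → EuclideanSpace ℝ (Fin 3), bt = fun τ => w τ 0 - U τ 0 := ⟨_, rfl⟩
  have hbt_cont : ContinuousOn bt (Ioo (1/2 : ℝ) T) := by
    rw [hbt]; exact ((hwcont 0).continuousOn).sub (hUline 0).1
  have hgood : ∀ᵐ τ ∂volume, τ ∈ Ioo 0 T → w τ = fun y => U τ y + b τ := by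
    have h1 := (ae_restrict_iff' (measurableSet_Ioo : MeasurableSet (Ioo (0:ℝ) T))).1 hae
    filter_upwards [h1] with τ hτ hτm
    exact (Continuous.ae_eq_iff_eq volume (hwcontx τ)
      ((hUs τ hτm).continuous.add continuous_const)).1 (hτ hτm)
  have hrep : ∀ τ ∈ Ioo (1/2 : ℝ) T, ∀ y, w τ y = U τ y + bt τ := by
    intro τ hτ y
    have hcont : ContinuousOn (fun σ => ‖(w σ y - U σ y) - bt σ‖) (Ioo (1/2 : ℝ) T) :=
      ((((hwcont y).continuousOn).sub (hUline y).1).sub hbt_cont).norm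
    have hae' : ∀ᵐ σ ∂(volume.restrict (Ioo (1/2 : ℝ) T)), ‖(w σ y - U σ y) - bt σ‖ ≤ 0 := by
      rw [ae_restrict_iff' measurableSet_Ioo]
      filter_upwards [hgood] with σ hσ hσS
      have e := hσ (hSsub hσS)
      have e1 : w σ y = U σ y + b σ := by rw [e]
      have e0 : w σ 0 = U σ 0 + b σ := by rw [e]
      rw [hbt]; dsimp only
      rw [e1, e0]; simp
    have h0 := ChaeWolf.le_of_ae_le_of_continuousOn hcont hae' τ hτ
    have h00 : ‖(w τ y - U τ y) - bt τ‖ = 0 := le_antisymm h0 (norm_nonneg _)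
    rw [norm_eq_zero, sub_eq_zero] at h00
    rw [← h00]; abel
  have hrepF : ∀ τ ∈ Ioo (1/2 : ℝ) T, w τ = fun y => U τ y + bt τ := fun τ hτ => funext (hrep τ hτ)
  have hcurlw : ∀ τ ∈ Ioo (1/2 : ℝ) T, curl (w τ) = curl (U τ) := fun τ hτ => by
    funext y; rw [hrepF τ hτ]; exact curl_add_const_eq (U τ) (bt τ) y
  have hfdw : ∀ τ ∈ Ioo (1/2 : ℝ) T, ∀ y, fderiv ℝ (w τ) y = fderiv ℝ (U τ) y := fun τ hτ y => by
    rw [hrepF τ hτ]; exact fderiv_add_const _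
  have hsmooth : ∀ τ ∈ Ioo (1/2 : ℝ) T, ContDiff ℝ ∞ (w τ) := fun τ hτ => by
    rw [hrepF τ hτ]; exact (hUs τ (hSsub hτ)).add contDiff_const
  -- `b = bt` at almost every time of `(1/2, T)`
  have hbbt : ∀ᵐ σ ∂volume, σ ∈ Ioo (1/2 : ℝ) T → b σ = bt σ := by
    filter_upwards [hgood] with σ hσ hσS
    have e := hσ (hSsub hσS)
    have e0 : w σ 0 = U σ 0 + b σ := by rw [e]
    exact add_left_cancel (e0.symm.trans (hrep σ hσS 0))
  -- the continuous integrand of the vorticity identity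
  obtain ⟨G, hG⟩ : ∃ G : ℝ → EuclideanSpace ℝ (Fin 3), G = fun σ =>
      (Δ (curl (U σ))) x - fderiv ℝ (curl (U σ)) x (U σ x + bt σ) + fderiv ℝ (U σ) x (curl (U σ) x) :=
    ⟨_, rfl⟩
  have hGcont : ContinuousOn G (Ioo (1/2 : ℝ) T) := by
    obtain ⟨ha, hb', hc, hd, he⟩ := hUline x
    rw [hG]
    exact (he.sub (hd.clm_apply (ha.add hbt_cont))).add (hb'.clm_apply hc)
  -- the identity from the base time `1`, with `bt` in place of `b`
  have hint_eq : ∀ τ ∈ Ioo (1 : ℝ) T, curl (U τ) x = curl (U 1) x + ∫ σ in (1:ℝ)..τ, G σ := by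
    intro τ hτ
    have h1 := hident x 1 τ one_pos hτ.1.le hτ.2
    have h2 : (∫ σ in (1:ℝ)..τ, ((Δ (curl (U σ))) x - fderiv ℝ (curl (U σ)) x (U σ x + b σ) +
        fderiv ℝ (U σ) x (curl (U σ) x))) = ∫ σ in (1:ℝ)..τ, G σ := by
      refine intervalIntegral.integral_congr_ae ?_
      filter_upwards [hbbt] with σ hσ hσI
      have hσS : σ ∈ Ioo (1/2 : ℝ) T := by
        rw [uIoc_of_le hτ.1.le] at hσI
        exact ⟨by linarith [hσI.1], lt_of_le_of_lt hσI.2 hτ.2⟩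
      rw [hG, hσ hσS]
    rw [← h2, ← h1]; abel
  -- FTC at `τ = 2`
  have h2S : (2 : ℝ) ∈ Ioo (1/2 : ℝ) T := by rw [hT]; constructor <;> norm_num
  have h2I : (2 : ℝ) ∈ Ioo (1 : ℝ) T := by rw [hT]; constructor <;> norm_num
  have hderivU : HasDerivAt (fun τ => curl (U τ) x) (G 2) 2 := by
    have hi : IntervalIntegrable G volume 1 2 := by
      refine (hGcont.mono ?_).intervalIntegrable
      rw [uIcc_of_le (by norm_num : (1:ℝ) ≤ 2)]
      intro σ hσ
      exact ⟨by linarith [hσ.1], by rw [hT]; linarith [hσ.2]⟩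
    have hm : StronglyMeasurableAtFilter G (𝓝 (2:ℝ)) volume :=
      hGcont.stronglyMeasurableAtFilter isOpen_Ioo 2 h2S
    have hc : ContinuousAt G 2 := hGcont.continuousAt (Ioo_mem_nhds h2S.1 h2S.2)
    have hF := intervalIntegral.integral_hasDerivAt_right hi hm hc
    have hF' : HasDerivAt (fun τ => curl (U 1) x + ∫ σ in (1:ℝ)..τ, G σ) (G 2) 2 := hF.const_add _
    refine hF'.congr_of_eventuallyEq ?_
    filter_upwards [Ioo_mem_nhds h2I.1 h2I.2] with τ hτ
    exact hint_eq τ hτ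
  have hderivW : HasDerivAt (fun τ => curl (w τ) x) (G 2) 2 := by
    refine hderivU.congr_of_eventuallyEq ?_
    filter_upwards [Ioo_mem_nhds h2S.1 h2S.2] with τ hτ
    show curl (w τ) x = curl (U τ) x
    rw [hcurlw τ hτ]
  -- back to `v`: `w 2 = v t₁`, `w (t + (2 − t₁)) = v t`
  have hw2 : w 2 = v t₁ := by rw [hw]; dsimp only; congr 1; ring
  have hG2 : G 2 = (Δ (curl (v t₁))) x - fderiv ℝ (curl (v t₁)) x (v t₁ x) +
      fderiv ℝ (v t₁) x (curl (v t₁) x) := by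
    rw [hG]; dsimp only
    rw [← hcurlw 2 h2S, ← hfdw 2 h2S x, ← hrep 2 h2S x, hw2]
  refine ⟨hw2 ▸ hsmooth 2 h2S, ?_⟩
  have e2 : t₁ + (2 - t₁) = 2 := by ring
  have hderivW' : HasDerivAt (fun τ => curl (w τ) x) (G 2) (t₁ + (2 - t₁)) := by rw [e2]; exact hderivW
  have hcomp := hderivW'.comp_add_const t₁ (2 - t₁)
  have hfun2 : (fun t => curl (w (t + (2 - t₁))) x) = fun t => curl (v t) x := by
    funext t; rw [hw]; dsimp only; congr 2; ring
  rw [hfun2, hG2] at hcomp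
  exact hcomp

end Summit.NavierStokesRegularity.NavierStokesRegularity.Theorems.StrainDoors

end
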